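import Summits.MatrixMultiplication.OmegaCensus.STPP222CubeExponent
import Summits.MatrixMultiplication.OmegaCensus.STPP222CubeSeedsA
import Summits.MatrixMultiplication.OmegaCensus.STPP222CubeSeedsB
import Mathlib.GroupTheory.FiniteAbelian.Basic
import Mathlib.Algebra.DirectSum.Module
import Mathlib.Tactic.NormNum.Prime

/-!
# ω-census, STPP law `(2,2,2)³`: EVERY finite abelian group of order `≥ 46` admits it (`stpp222CubeFrom46`)

HONEST FRAMING (pub-omega census; verbatim): lottery ticket; floor = certified bounds/negative ranges.
Census STRUCTURE bookkeeping, not progress on `ω`: a `(2,2,2)³` STPP family (three simultaneous `⟨2,2,2⟩`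
triples, CKSU 2005 Def. 5.1, tree form `IsSTPP`) yields no matrix-multiplication bound of interest.

This file closes the census conjecture C4‴ / `STPP222CubeFrom46` in the kernel:

* `exists_isSTPP_222cube_of_card` — **every finite abelian group `G` with `46 ≤ |G|` has
  `A B C : Fin 3 → Finset G`, all of cardinality `2`, with `IsSTPP A B C`.**

The constant `46` is sharp on the census side (`ℤ/41`, `ℤ/43`, `ℤ/m` for `m ≤ 40` are infeasible by complete
search — engine results, not kernel theorems, and not used here).

Proof (the reduction recorded in HOME `pub-omega-eng2/results/c4red/C4-REDUCTION-eng2.md` §2/§5, made formal):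
1. If the exponent of `G` is `≥ 46`, `STPP222CubeExponent.lean` applies (an element of order `≥ 46` generates a
   cyclic subgroup `ℤ/m`, `m ≥ 46`, and `STPP222CubeCyclic.lean` + transport along the injection).
2. Otherwise `1 ≤ exponent ≤ 45`.  By the structure theorem (`AddCommGroup.equiv_directSum_zmod_of_finite`)
   `G ≃+ ⨁ᵢ ℤ/(pᵢ^{eᵢ})`, and the multiset `M` of the nontrivial prime powers `qᵢ = pᵢ^{eᵢ} > 1` consists of
   prime powers dividing the exponent (so all in the list of the 21 prime powers `≤ 45`) with product `|G| ≥ 46`.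
3. COMBINATORIAL CORE (kernel `decide`): every such multiset DOMINATES one of the 60 seed multisets of
   `STPP222CubeSeedsA/B.lean` — there is an injection from the seed's factors `s_j` to distinct elements `x` of
   `M` with `s_j ∣ x` (`dom`).  Unbounded multiplicities are handled by capping: `M ∩ C_E`, where `C_E` contains
   each prime-power divisor `v` of the exponent `E` with multiplicity `c(v)` chosen so that `v^{c(v)} ≥ 46`, still
   has product `≥ 46`, and the capped multisets are finitely many (`subMS`, ≈ 3.5k over all `E ≤ 45`), so the
   domination statement `dom_of_capped` is a closed decidable proposition.
4. GENERIC EMBEDDING: `dom s M` yields an injective additive hom `ℤ/s₁ × (ℤ/s₂ × ⋯) →+ Πᵢ ℤ/qᵢ`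
   (`ℤ/a ↪ ℤ/q` for `a ∣ q` via an element of order `a`, placed in distinct coordinates; `exists_emb_of_dom`),
   and `IsSTPP` is transported along injective homs (`IsSTPP.image`).

References: H. Cohn, R. Kleinberg, B. Szegedy, C. Umans, FOCS 2005 (arXiv:math/0511460), Def. 5.1.
Record: pub-omega HOME `pub-omega-eng2/results/c4red/C4-REDUCTION-eng2.md` (ENG2 gen 14/15, 2026-08-23),
pre-registrations P-009/P-010.
-/

open Literature.Computability.AlgebraicComplexity Finset

namespace Summit.MatrixMultiplication.OmegaCensus

/-! ## 1. The combinatorial core: seed types, domination, capped multisets -/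

/-- The product group `ℤ/s₁ × (ℤ/s₂ × (⋯ × ℤ/s_k))` attached to a list of moduli (right-nested, exactly the
shape of the seed statements of `STPP222CubeSeedsA/B.lean`; `Unit` for the empty list). -/
def SeedType : List ℕ → Type
  | [] => Unit
  | [a] => ZMod a
  | a :: b :: s => ZMod a × SeedType (b :: s)

/-- The abelian group structure on `SeedType s` (the product structure). -/
instance instAddCommGroupSeedType : (s : List ℕ) → AddCommGroup (SeedType s)
  | [] => inferInstanceAs (AddCommGroup Unit)
  | [a] => inferInstanceAs (AddCommGroup (ZMod a))
  | a :: b :: s =>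
      letI : AddCommGroup (SeedType (b :: s)) := instAddCommGroupSeedType (b :: s)
      inferInstanceAs (AddCommGroup (ZMod a × SeedType (b :: s)))

/-- A seed: a list of moduli together with a kernel proof that the corresponding product group admits the
STPP pattern `(2,2,2)³`. [cite: CohnKleinbergSzegedyUmans2005, Def. 5.1] -/
structure Seed where
  /-- the moduli `s₁, …, s_k` (prime powers), in the order of the seed theorem's product type -/
  s : List ℕ
  /-- the product group `ℤ/s₁ × ⋯ × ℤ/s_k` admits three simultaneous-TPP triples of 2-subsets -/
  ok : ∃ A B C : Fin 3 → Finset (SeedType s), IsSTPP A B C ∧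
    ∀ i, (A i).card = 2 ∧ (B i).card = 2 ∧ (C i).card = 2

/-- The 60 seeds of `STPP222CubeSeedsA/B.lean` (the non-cyclic abelian groups `K` with `46 ≤ |K| < 46·p_min(K)`),
listed in an order that makes the kernel search `dom_of_capped` cheap. -/
def seeds : List Seed := [
  ⟨[4, 4, 2, 2], exists_isSTPP_222cube_seed_4_4_2_2⟩, ⟨[2, 3, 3, 3], exists_isSTPP_222cube_seed_2_3_3_3⟩,
  ⟨[2, 2, 2, 2, 2, 2], exists_isSTPP_222cube_seed_2_2_2_2_2_2⟩, ⟨[2, 5, 5], exists_isSTPP_222cube_seed_2_5_5⟩,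
  ⟨[3, 3, 3, 3], exists_isSTPP_222cube_seed_3_3_3_3⟩, ⟨[2, 2, 2, 2, 3], exists_isSTPP_222cube_seed_2_2_2_2_3⟩,
  ⟨[4, 4, 4], exists_isSTPP_222cube_seed_4_4_4⟩, ⟨[7, 7], exists_isSTPP_222cube_seed_7_7⟩,
  ⟨[9, 9], exists_isSTPP_222cube_seed_9_9⟩, ⟨[8, 8], exists_isSTPP_222cube_seed_8_8⟩,
  ⟨[5, 5, 5], exists_isSTPP_222cube_seed_5_5_5⟩, ⟨[4, 2, 2, 2, 2], exists_isSTPP_222cube_seed_4_2_2_2_2⟩,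
  ⟨[11, 11], exists_isSTPP_222cube_seed_11_11⟩, ⟨[2, 2, 2, 3, 3], exists_isSTPP_222cube_seed_2_2_2_3_3⟩,
  ⟨[4, 4, 3], exists_isSTPP_222cube_seed_4_4_3⟩, ⟨[2, 2, 2, 7], exists_isSTPP_222cube_seed_2_2_2_7⟩,
  ⟨[3, 5, 5], exists_isSTPP_222cube_seed_3_5_5⟩, ⟨[13, 13], exists_isSTPP_222cube_seed_13_13⟩,
  ⟨[2, 2, 2, 2, 5], exists_isSTPP_222cube_seed_2_2_2_2_5⟩, ⟨[16, 2, 2], exists_isSTPP_222cube_seed_16_2_2⟩,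
  ⟨[2, 2, 2, 11], exists_isSTPP_222cube_seed_2_2_2_11⟩, ⟨[2, 2, 17], exists_isSTPP_222cube_seed_2_2_17⟩,
  ⟨[2, 2, 19], exists_isSTPP_222cube_seed_2_2_19⟩, ⟨[9, 3, 3], exists_isSTPP_222cube_seed_9_3_3⟩,
  ⟨[2, 9, 3], exists_isSTPP_222cube_seed_2_9_3⟩, ⟨[3, 3, 7], exists_isSTPP_222cube_seed_3_3_7⟩,
  ⟨[4, 2, 2, 5], exists_isSTPP_222cube_seed_4_2_2_5⟩, ⟨[4, 2, 2, 3], exists_isSTPP_222cube_seed_4_2_2_3⟩,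
  ⟨[8, 2, 2, 2], exists_isSTPP_222cube_seed_8_2_2_2⟩, ⟨[8, 4, 2], exists_isSTPP_222cube_seed_8_4_2⟩,
  ⟨[2, 2, 13], exists_isSTPP_222cube_seed_2_2_13⟩, ⟨[4, 2, 3, 3], exists_isSTPP_222cube_seed_4_2_3_3⟩,
  ⟨[16, 4], exists_isSTPP_222cube_seed_16_4⟩, ⟨[17, 17], exists_isSTPP_222cube_seed_17_17⟩,
  ⟨[19, 19], exists_isSTPP_222cube_seed_19_19⟩, ⟨[2, 2, 3, 5], exists_isSTPP_222cube_seed_2_2_3_5⟩,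
  ⟨[3, 3, 3, 5], exists_isSTPP_222cube_seed_3_3_3_5⟩, ⟨[4, 4, 5], exists_isSTPP_222cube_seed_4_4_5⟩,
  ⟨[25, 5], exists_isSTPP_222cube_seed_25_5⟩, ⟨[2, 2, 2, 9], exists_isSTPP_222cube_seed_2_2_2_9⟩,
  ⟨[3, 3, 11], exists_isSTPP_222cube_seed_3_3_11⟩, ⟨[3, 3, 13], exists_isSTPP_222cube_seed_3_3_13⟩,
  ⟨[4, 2, 11], exists_isSTPP_222cube_seed_4_2_11⟩, ⟨[4, 2, 7], exists_isSTPP_222cube_seed_4_2_7⟩,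
  ⟨[23, 23], exists_isSTPP_222cube_seed_23_23⟩, ⟨[27, 3], exists_isSTPP_222cube_seed_27_3⟩,
  ⟨[29, 29], exists_isSTPP_222cube_seed_29_29⟩, ⟨[2, 2, 3, 7], exists_isSTPP_222cube_seed_2_2_3_7⟩,
  ⟨[2, 3, 3, 5], exists_isSTPP_222cube_seed_2_3_3_5⟩, ⟨[31, 31], exists_isSTPP_222cube_seed_31_31⟩,
  ⟨[32, 2], exists_isSTPP_222cube_seed_32_2⟩, ⟨[37, 37], exists_isSTPP_222cube_seed_37_37⟩,
  ⟨[41, 41], exists_isSTPP_222cube_seed_41_41⟩, ⟨[43, 43], exists_isSTPP_222cube_seed_43_43⟩,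
  ⟨[4, 2, 9], exists_isSTPP_222cube_seed_4_2_9⟩, ⟨[5, 5, 7], exists_isSTPP_222cube_seed_5_5_7⟩,
  ⟨[8, 2, 3], exists_isSTPP_222cube_seed_8_2_3⟩, ⟨[8, 2, 5], exists_isSTPP_222cube_seed_8_2_5⟩,
  ⟨[8, 3, 3], exists_isSTPP_222cube_seed_8_3_3⟩, ⟨[9, 3, 5], exists_isSTPP_222cube_seed_9_3_5⟩]

/-- **Domination** (Boolean transcription) of a list of moduli by a multiset of naturals: the moduli
`a₁, a₂, …` can be assigned to DISTINCT elements `x₁, x₂, …` of `M` (counted with multiplicity) with `aⱼ ∣ xⱼ`.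
Defined by structural recursion (bounded search over `M`) so that the kernel can evaluate it and a witness can be
peeled off one modulus at a time (`dom_cons`). -/
def dom : List ℕ → Multiset ℕ → Bool
  | [], _ => true
  | a :: s, M =>
      @decide (∃ x ∈ M, a ∣ x ∧ dom s (M.erase x) = true)
        (@Multiset.decidableExistsMultiset ℕ M (fun x => a ∣ x ∧ dom s (M.erase x) = true)
          (fun x => @instDecidableAnd _ _ (Nat.decidable_dvd a x) (instDecidableEqBool _ _)))

/-- Unfolding `dom` on a nonempty list of moduli. -/
theorem dom_cons {a : ℕ} {s : List ℕ} {M : Multiset ℕ} :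
    dom (a :: s) M = true ↔ ∃ x ∈ M, a ∣ x ∧ dom s (M.erase x) = true := by
  simp only [dom, decide_eq_true_eq]

/-- Domination is monotone in the multiset. -/
theorem dom_mono : ∀ (s : List ℕ) {M M' : Multiset ℕ}, M' ≤ M → dom s M' = true → dom s M = true
  | [], _, _, _, _ => rfl
  | a :: s, _, _, hle, h => by
      obtain ⟨x, hx, hax, hD⟩ := dom_cons.1 h
      exact dom_cons.2 ⟨x, Multiset.mem_of_le hle hx, hax, dom_mono s (Multiset.erase_le_erase x hle) hD⟩

/-- The 21 prime powers `≤ 45`. -/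
def ppList : List ℕ := [2, 4, 8, 16, 32, 3, 9, 27, 5, 25, 7, 11, 13, 17, 19, 23, 29, 31, 37, 41, 43]

/-- The cap `c(v)` for a prime power `v`: the least `c` with `v ^ c ≥ 46` (for `v ∈ ppList`). -/
def cap (v : ℕ) : ℕ := if v = 2 then 6 else if v = 3 then 4 else if v ≤ 5 then 3 else 2

/-- For a modulus `E`, the prime powers `≤ 45` dividing `E`, each paired with its cap. -/
def capList (E : ℕ) : List (ℕ × ℕ) := (ppList.filter (· ∣ E)).map fun v => (v, cap v)

/-- The capping multiset of a list of (value, cap) pairs: each value with multiplicity its cap. -/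
def capMS : List (ℕ × ℕ) → Multiset ℕ
  | [] => 0
  | vc :: L => Multiset.replicate vc.2 vc.1 + capMS L

/-- All sub-multisets of `capMS L`, enumerated by count vectors (no repetition blow-up). -/
def subMS : List (ℕ × ℕ) → List (Multiset ℕ)
  | [] => [0]
  | vc :: L => (subMS L).flatMap fun m => (List.range (vc.2 + 1)).map fun k => Multiset.replicate k vc.1 + m

/-- Completeness of the enumeration `subMS`: every sub-multiset of `capMS L` is listed. -/
theorem mem_subMS_of_le : ∀ (L : List (ℕ × ℕ)) (M : Multiset ℕ), M ≤ capMS L → M ∈ subMS L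
  | [], M, h => by
      have hM : M = 0 := by simpa [capMS] using h
      subst hM; simp [subMS]
  | (v, c) :: L, M, h => by
      simp only [capMS] at h
      set k := min (Multiset.count v M) c with hk
      have hkle : Multiset.replicate k v ≤ M :=
        Multiset.le_count_iff_replicate_le.1 (min_le_left _ _)
      have hrest : M - Multiset.replicate k v ≤ capMS L := by
        rw [Multiset.le_iff_count]
        intro a
        rw [Multiset.count_sub, Multiset.count_replicate]
        have ha := Multiset.le_iff_count.1 h a
        rw [Multiset.count_add, Multiset.count_replicate] at ha
        by_cases hav : v = a
        · rw [if_pos hav] at ha ⊢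
          subst hav
          omega
        · rw [if_neg hav] at ha ⊢
          omega
      have hmem := mem_subMS_of_le L _ hrest
      simp only [subMS, List.mem_flatMap, List.mem_map, List.mem_range]
      refine ⟨M - Multiset.replicate k v, hmem, k, by omega, ?_⟩
      rw [add_comm, tsub_add_cancel_of_le hkle]

/-- COMBINATORIAL CORE (kernel decision, ≈ 3.5k capped multisets): for every modulus `1 ≤ E ≤ 45`, every
sub-multiset of the capping multiset `C_E` with product `≥ 46` dominates one of the 60 seeds. -/
theorem dom_of_capped : ∀ E ∈ List.range' 1 45, ∀ M ∈ subMS (capList E), 46 ≤ M.prod →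
    ∃ sd ∈ seeds, dom sd.s M = true := by
  decide +kernel

/-- The caps are large enough: `v ^ (multiplicity of v in C_E) ≥ 46` for every prime power `v ≤ 45` dividing
`E`, `1 ≤ E ≤ 45` (kernel decision). -/
theorem cap_spec : ∀ E ∈ List.range' 1 45, ∀ v ∈ ppList, v ∣ E →
    46 ≤ v ^ Multiset.count v (capMS (capList E)) := by
  decide +kernel

/-- A prime power `p ^ k ≤ 45` with `k ≥ 1` is one of the 21 listed prime powers. -/
theorem pow_mem_ppList {p k : ℕ} (hp : p.Prime) (hk : 0 < k) (h : p ^ k ≤ 45) : p ^ k ∈ ppList := by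
  have hp2 := hp.two_le
  have hp45 : p ≤ 45 := le_trans (Nat.le_self_pow hk.ne' p) h
  have hk5 : k ≤ 5 := by
    by_contra hk6
    have h64 : 2 ^ 6 ≤ p ^ k :=
      le_trans (Nat.pow_le_pow_right (by norm_num) (by omega)) (Nat.pow_le_pow_left hp2 k)
    omega
  interval_cases p <;> interval_cases k <;>
    first | decide | (exfalso; revert hp; norm_num; done) | (exfalso; revert h; norm_num)

/-- Elements of `ppList` are positive. -/
theorem one_le_of_mem_ppList {a : ℕ} (h : a ∈ ppList) : 1 ≤ a := by
  simp only [ppList, List.mem_cons, List.mem_nil_iff, or_false] at h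
  omega

/-! ## 2. The capping step: from an arbitrary multiset of prime-power divisors of `E` to a capped one -/

/-- If every element `a` of `M` satisfies `46 ≤ a ^ count a C` and `1 ≤ a`, and `46 ≤ M.prod`, then the capped
multiset `M ∩ C` still has product `≥ 46`. -/
theorem prod_inter_ge {M C : Multiset ℕ} (hM : 46 ≤ M.prod) (hpos : ∀ a ∈ M, 1 ≤ a)
    (hcap : ∀ a ∈ M, 46 ≤ a ^ Multiset.count a C) : 46 ≤ (M ∩ C).prod := by
  by_cases hle : M ≤ C
  · have : M ∩ C = M := le_antisymm Multiset.inter_le_left (Multiset.le_inter le_rfl hle)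
    rw [this]; exact hM
  · rw [Multiset.le_iff_count] at hle
    push Not at hle
    obtain ⟨a, ha⟩ := hle
    have haM : a ∈ M := Multiset.count_pos.1 (by omega)
    have hcnt : Multiset.count a (M ∩ C) = Multiset.count a C := by
      rw [Multiset.count_inter]; omega
    have hrep : Multiset.replicate (Multiset.count a C) a ≤ M ∩ C :=
      Multiset.le_count_iff_replicate_le.1 hcnt.ge
    obtain ⟨R, hR⟩ := Multiset.le_iff_exists_add.1 hrep
    have hRpos : ∀ x ∈ R, 1 ≤ x := fun x hx =>
      hpos x (Multiset.mem_of_le Multiset.inter_le_left (hR ▸ Multiset.mem_add.2 (Or.inr hx)))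
    have h1 : 1 ≤ R.prod := Multiset.one_le_prod_of_one_le hRpos
    rw [hR, Multiset.prod_add, Multiset.prod_replicate]
    calc 46 ≤ a ^ Multiset.count a C := hcap a haM
      _ = a ^ Multiset.count a C * 1 := (mul_one _).symm
      _ ≤ a ^ Multiset.count a C * R.prod := Nat.mul_le_mul_left _ h1

/-- **Domination for an arbitrary multiset**: a multiset of prime powers from `ppList`, all dividing some
`1 ≤ E ≤ 45`, with product `≥ 46`, dominates one of the 60 seeds. -/
theorem exists_seed_dom {M : Multiset ℕ} {E : ℕ} (hE1 : 1 ≤ E) (hE45 : E ≤ 45)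
    (hpp : ∀ a ∈ M, a ∈ ppList) (hdvd : ∀ a ∈ M, a ∣ E) (hprod : 46 ≤ M.prod) :
    ∃ sd ∈ seeds, dom sd.s M = true := by
  have hEI : E ∈ List.range' 1 45 := List.mem_range'_1.2 ⟨hE1, by omega⟩
  set C := capMS (capList E) with hC
  have hcapd := prod_inter_ge (C := C) hprod (fun a ha => one_le_of_mem_ppList (hpp a ha))
    (fun a ha => cap_spec E hEI a (hpp a ha) (hdvd a ha))
  have hmem : M ∩ C ∈ subMS (capList E) := mem_subMS_of_le _ _ Multiset.inter_le_right
  obtain ⟨sd, hsd, hD⟩ := dom_of_capped E hEI (M ∩ C) hmem hcapd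
  exact ⟨sd, hsd, dom_mono sd.s Multiset.inter_le_left hD⟩

/-! ## 3. Generic embedding of a dominated seed into `Π i, ℤ/qᵢ` -/

/-- `ℤ/a` embeds into the `i`-th coordinate of `Π j, ℤ/(q j)` whenever `a ∣ q i ≠ 0` (via the element
`(q i / a) · δᵢ` of additive order `a` and `ZMod.lift`), with image supported on the coordinate `i`. -/
theorem exists_emb_single {ι : Type*} [DecidableEq ι] (q : ι → ℕ) (i : ι) (hq : q i ≠ 0) (a : ℕ)
    (ha : a ∣ q i) :
    ∃ φ : ZMod a →+ (Π j, ZMod (q j)), Function.Injective φ ∧ ∀ x j, j ≠ i → φ x j = 0 := by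
  obtain ⟨c, hc⟩ : ∃ c : ZMod (q i), addOrderOf c = a :=
    ⟨((q i / a : ℕ) : ZMod (q i)), by
      rw [ZMod.addOrderOf_coe _ hq, Nat.gcd_eq_right (Nat.div_dvd_of_dvd ha), Nat.div_div_self ha hq]⟩
  subst hc
  refine ⟨(AddMonoidHom.single (fun j => ZMod (q j)) i).comp
      (ZMod.lift (addOrderOf c) ⟨zmultiplesHom _ c, zmultiples_lift_spec c⟩), ?_, ?_⟩
  · exact (Pi.single_injective i).comp (zmod_lift_zmultiples_injective c)
  · intro x j hj
    simp [Pi.single_eq_of_ne hj]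

/-- Two injective additive homs into a product `Π j, N j` whose images are supported on complementary sets of
coordinates combine (`AddMonoidHom.coprod`) to an injective hom on the product of their sources. -/
theorem coprod_injective_of_support {ι : Type*} {A B : Type*} [AddCommGroup A] [AddCommGroup B]
    {N : ι → Type*} [∀ j, AddCommGroup (N j)] (φ : A →+ Π j, N j) (ψ : B →+ Π j, N j) (S : ι → Prop)
    (hφ : Function.Injective φ) (hψ : Function.Injective ψ)
    (hφS : ∀ x j, ¬ S j → φ x j = 0) (hψS : ∀ y j, S j → ψ y j = 0) :
    Function.Injective (φ.coprod ψ) := by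
  rw [injective_iff_map_eq_zero]
  rintro ⟨x, y⟩ h
  rw [AddMonoidHom.coprod_apply] at h
  have hx : φ x = 0 := by
    funext j
    by_cases hj : S j
    · have := congr_fun h j
      simp only [Pi.add_apply, hψS y j hj, add_zero, Pi.zero_apply] at this
      exact this
    · exact hφS x j hj
  have hx0 : x = 0 := hφ (by rw [hx, map_zero])
  rw [hx, zero_add] at h
  have hy0 : y = 0 := hψ (by rw [h, map_zero])
  rw [hx0, hy0]
  rfl

/-- **Generic embedding.** If the list of moduli `s` is dominated by the multiset `{q i : i ∈ I}`, then the seed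
group `SeedType s = ℤ/s₁ × (ℤ/s₂ × ⋯)` embeds into `Π j, ℤ/(q j)` with image supported on the coordinates in `I`
(structural recursion on `s`, peeling one modulus and one index at a time). -/
theorem exists_emb_of_dom {ι : Type*} [DecidableEq ι] (q : ι → ℕ) (hq : ∀ i, q i ≠ 0) :
    ∀ (s : List ℕ) (I : Finset ι), dom s (I.val.map q) = true →
      ∃ φ : SeedType s →+ (Π j, ZMod (q j)), Function.Injective φ ∧ ∀ x, ∀ j ∉ I, φ x j = 0
  | [], I, _ => ⟨0, fun (a : Unit) (b : Unit) _ => Subsingleton.elim a b, fun _ _ _ => rfl⟩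
  | [a], I, h => by
      obtain ⟨x, hx, hax, -⟩ := dom_cons.1 h
      obtain ⟨i, hi, rfl⟩ := Multiset.mem_map.1 hx
      obtain ⟨φ, hφ, hsupp⟩ := exists_emb_single q i (hq i) a hax
      exact ⟨φ, hφ, fun y j hj => hsupp y j (fun h => hj (h ▸ hi))⟩
  | a :: b :: t, I, h => by
      obtain ⟨x, hx, hax, hD⟩ := dom_cons.1 h
      obtain ⟨i, hi, rfl⟩ := Multiset.mem_map.1 hx
      have hD' : dom (b :: t) ((I.erase i).val.map q) = true := by
        rwa [Finset.erase_val, Multiset.map_erase_of_mem _ _ hi]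
      obtain ⟨ψ, hψ, hψsupp⟩ := exists_emb_of_dom q hq (b :: t) (I.erase i) hD'
      obtain ⟨φ, hφ, hφsupp⟩ := exists_emb_single q i (hq i) a hax
      have hψi : ∀ y j, j = i → ψ y j = 0 := fun y j hj => by
        rw [hj]; exact hψsupp y i (Finset.notMem_erase i I)
      have hsupp : ∀ (z : ZMod a × SeedType (b :: t)) (j : ι), j ∉ I → (φ.coprod ψ) z j = 0 := by
        intro z j hj
        rw [AddMonoidHom.coprod_apply, Pi.add_apply, hφsupp z.1 j (fun h => hj (h ▸ hi)),
          hψsupp z.2 j (fun h => hj (Finset.mem_of_mem_erase h)), add_zero]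
      exact ⟨φ.coprod ψ, coprod_injective_of_support φ ψ (fun j => j = i) hφ hψ hφsupp hψi, hsupp⟩

/-! ## 4. Assembly -/

/-- Transport of the `(2,2,2)³` statement along an injective additive hom (`IsSTPP.image` + injectivity of
`Finset.image`). [cite: CohnKleinbergSzegedyUmans2005, Def. 5.1] -/
theorem exists_isSTPP_222cube_of_injective {H K : Type*} [AddCommGroup H] [AddCommGroup K]
    (φ : H →+ K) (hφ : Function.Injective φ)
    (h : ∃ A B C : Fin 3 → Finset H, IsSTPP A B C ∧
      ∀ i, (A i).card = 2 ∧ (B i).card = 2 ∧ (C i).card = 2) :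
    ∃ A B C : Fin 3 → Finset K, IsSTPP A B C ∧ ∀ i, (A i).card = 2 ∧ (B i).card = 2 ∧ (C i).card = 2 := by
  classical
  obtain ⟨A, B, C, hS, hc⟩ := h
  refine ⟨fun i => (A i).image φ, fun i => (B i).image φ, fun i => (C i).image φ, hS.image φ hφ,
    fun i => ?_⟩
  obtain ⟨hA, hB, hC⟩ := hc i
  exact ⟨by rw [card_image_of_injective _ hφ, hA], by rw [card_image_of_injective _ hφ, hB],
    by rw [card_image_of_injective _ hφ, hC]⟩

/-- **The product case.** `Π i, ℤ/(pᵢ^{eᵢ})` (primes `pᵢ`, finitely many `i`) admits `(2,2,2)³` as soon as every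
`pᵢ^{eᵢ}` divides some `1 ≤ E ≤ 45` and `∏ pᵢ^{eᵢ} ≥ 46`: the multiset of nontrivial factors dominates a seed
(`exists_seed_dom`), the seed group embeds (`exists_emb_of_dom`), and the seed's kernel witness is transported.
[cite: CohnKleinbergSzegedyUmans2005, Def. 5.1] -/
theorem exists_isSTPP_222cube_pi {ι : Type} [Fintype ι] [DecidableEq ι] (p e : ι → ℕ)
    (hp : ∀ i, (p i).Prime) {E : ℕ} (hE1 : 1 ≤ E) (hE45 : E ≤ 45) (hdvd : ∀ i, p i ^ e i ∣ E)
    (hcard : 46 ≤ ∏ i, p i ^ e i) :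
    ∃ A B C : Fin 3 → Finset (Π i, ZMod (p i ^ e i)), IsSTPP A B C ∧
      ∀ i, (A i).card = 2 ∧ (B i).card = 2 ∧ (C i).card = 2 := by
  have hq0 : ∀ i, p i ^ e i ≠ 0 := fun i => pow_ne_zero _ (hp i).ne_zero
  have hprod : 46 ≤ ((Finset.univ.filter fun i => 0 < e i).val.map fun i => p i ^ e i).prod := by
    have : ((Finset.univ.filter fun i => 0 < e i).val.map fun i => p i ^ e i).prod = ∏ i, p i ^ e i := by
      rw [← Finset.prod_eq_multiset_prod]
      exact Finset.prod_filter_of_ne fun i _ hi => Nat.pos_of_ne_zero fun h0 => hi (by rw [h0, pow_zero])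
    rw [this]; exact hcard
  have hmem : ∀ a ∈ ((Finset.univ.filter fun i => 0 < e i).val.map fun i => p i ^ e i),
      a ∈ ppList ∧ a ∣ E := by
    intro a ha
    obtain ⟨i, hi, rfl⟩ := Multiset.mem_map.1 ha
    have hi' : 0 < e i := (Finset.mem_filter.1 hi).2
    exact ⟨pow_mem_ppList (hp i) hi' (le_trans (Nat.le_of_dvd (by omega) (hdvd i)) hE45), hdvd i⟩
  obtain ⟨sd, -, hD⟩ :=
    exists_seed_dom hE1 hE45 (fun a ha => (hmem a ha).1) (fun a ha => (hmem a ha).2) hprod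
  obtain ⟨φ, hφ, -⟩ := exists_emb_of_dom (fun i => p i ^ e i) hq0 sd.s _ hD
  exact exists_isSTPP_222cube_of_injective φ hφ sd.ok

/-- **C4‴ / `STPP222CubeFrom46` (pub-omega census STRUCTURE law): every finite abelian group of order `≥ 46`
admits three simultaneous-TPP triples of 2-subsets** (CKSU 2005 Def. 5.1, tree form `IsSTPP`; the pattern
`(2,2,2)³`).  Exponent `≥ 46`: `exists_isSTPP_222cube_of_exponent`.  Exponent `≤ 45`: structure theorem
`AddCommGroup.equiv_directSum_zmod_of_finite` + `exists_isSTPP_222cube_pi` (kernel-decided domination of one of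
the 60 seed groups + generic embedding) + transport back along the isomorphism.  No `ω` bound follows.
[cite: CohnKleinbergSzegedyUmans2005, Def. 5.1] -/
theorem exists_isSTPP_222cube_of_card {G : Type*} [AddCommGroup G] [Finite G] (hG : 46 ≤ Nat.card G) :
    ∃ A B C : Fin 3 → Finset G, IsSTPP A B C ∧ ∀ i, (A i).card = 2 ∧ (B i).card = 2 ∧ (C i).card = 2 := by
  classical
  by_cases hexp : 46 ≤ AddMonoid.exponent G
  · exact exists_isSTPP_222cube_of_exponent hexp
  obtain ⟨ι, _, p, hp, e, ⟨g⟩⟩ := AddCommGroup.equiv_directSum_zmod_of_finite G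
  let f : G ≃+ (Π i, ZMod (p i ^ e i)) :=
    g.trans (DirectSum.linearEquivFunOnFintype ℕ ι (fun i => ZMod (p i ^ e i))).toAddEquiv
  have hE1 : 1 ≤ AddMonoid.exponent G := Nat.pos_of_ne_zero AddMonoid.exponent_ne_zero_of_finite
  have hdvd : ∀ i, p i ^ e i ∣ AddMonoid.exponent G := fun i => by
    have hinj : Function.Injective (AddMonoidHom.single (fun j => ZMod (p j ^ e j)) i) :=
      Pi.single_injective (M := fun j => ZMod (p j ^ e j)) i
    have h1 : addOrderOf (f.symm (AddMonoidHom.single (fun j => ZMod (p j ^ e j)) i 1)) = p i ^ e i := by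
      rw [AddEquiv.addOrderOf_eq, addOrderOf_injective _ hinj, ZMod.addOrderOf_one]
    rw [← h1]
    exact AddMonoid.addOrder_dvd_exponent _
  have hcard : 46 ≤ ∏ i, p i ^ e i := by
    have : Nat.card G = ∏ i, p i ^ e i := by
      rw [Nat.card_congr f.toEquiv, Nat.card_pi]
      simp [Nat.card_zmod]
    rw [← this]; exact hG
  have h := exists_isSTPP_222cube_pi p e hp hE1 (by omega) hdvd hcard
  exact exists_isSTPP_222cube_of_injective f.symm.toAddMonoidHom f.symm.injective h

/-- Census name of the law (STRUCTURE.md C4‴ / pre-registration P-010): `STPP222CubeFrom46`, i.e.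
`exists_isSTPP_222cube_of_card` under the name the census records use. [cite: CohnKleinbergSzegedyUmans2005, Def. 5.1] -/
theorem stpp222CubeFrom46 {G : Type*} [AddCommGroup G] [Finite G] (hG : 46 ≤ Nat.card G) :
    ∃ A B C : Fin 3 → Finset G, IsSTPP A B C ∧ ∀ i, (A i).card = 2 ∧ (B i).card = 2 ∧ (C i).card = 2 :=
  exists_isSTPP_222cube_of_card hG

end Summit.MatrixMultiplication.OmegaCensus
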